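import Summits.HodgeConjecture.CorCM.Census.CentralSquaresFourTypeLaw

/-!
# The square-central class, IX: THE DIHEDRAL FACTOR LAW — `μ(D₄ × E, (r², 1)) = φ₂(D₄ × E, (r², 1))` for every finite `2`-group `E` of order `≥ 4`

COR-CM (cell `pub-hodgecm2`), count-neutral kernel combinatorics by the binder seat b09 (gen 45; lane SQUARE-CENTRAL CLASS, part IX — the first row
family of the world `c ∈ [G, G]` with a structural law), instantiating part VIIIʼs four-type law (`isLeast_card_gfaces_generate_four`) BY NAME on the
concrete model `DihedralGroup 4 × E`.  Theorems only, plus small `decide`s on the eight elements of `DihedralGroup 4`; no certificate, no named fact, no `sorry`.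
HONEST FRAMING: `HC_CM` is NOT proved, here or anywhere in the tree; nothing here is a period or a headline.

**THE DIHEDRAL FACTOR LAW (`isLeast_card_gfaces_generate_dihedral_prod`).**  Let `E` be ANY finite group of order `2ᵏ` with `k ≥ 2` and let
`G = D₄ × E` with the central involution `c = (r², 1)` — which lies in `[G, G]`, so the commutator law of `Census/CyclicCharacterCommutatorLaw.lean` is silent.
Then the least number of faces whose base changes together with the pairs generate the Hodge lattice is EXACTLY the coinvariant fibre:
**`μ(G, c) = φ₂(G, c)`**.  (Galois CM fields with group `D₄ × E`, complex conjugation `(r², 1)`: e.g. an octic dihedral CM field composed with a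
totally real Galois `2`-extension of degree `≥ 4` linearly disjoint from it; for `E` elementary abelian the maximal real subfield is multiquadratic.)

THE DATUM.  `X₀ = {1, r, s, sr} ⊂ D₄` (`s = sr 0`, `sr = sr 1`, `r = r 1`), `T₀ = X₀ × E`, the swap `Q = (s, 1)` (`Q² = 1`), `T₁ = T₀·Q⁻¹ = {1, r³, s, sr³} × E`,
`𝓗 = T₀ ∖ T₁ = {r, sr} × E`, transversals `{r} × E ⊆ 𝓗` and `{1} × E ⊆ T₀ ∩ T₁`, `m = |E| ≥ 4`; the base block of `T₀` is `{T₀, T̄₀, T₁, T̄₁}` and the place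
permutation of `Q` exchanges `r ↔ sr` and `1 ↔ s` — eight-element checks (`decide`).

## References
* [Pohlmann1968] H. Pohlmann, Algebraic cycles on abelian varieties of complex multiplication type, Ann. of Math. 88 (1968), Thm 1.
* [Milne1999] J. S. Milne, Lefschetz motives and the Tate conjecture, Compositio Math. 117 (1999), Prop. 2.1, p. 54.
-/

namespace Summit.HodgeConjecture.CorCM.Census.CentralSquares

open Finset DihedralGroup
open Summit.HodgeConjecture.CorCM.Prior.AllgGroup.RfwfAllgGroup
open Summit.HodgeConjecture.CorCM.Census.BlockParity
open Summit.HodgeConjecture.CorCM.Census.Coinvariant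
open Summit.HodgeConjecture.CorCM.Census.TwistGeneration
open Summit.HodgeConjecture.CorCM.Census.BaseBlock

noncomputable section

/-! ## §1 Eight-element facts about `D₄` -/

/-- `X₀ = {1, r, s, sr}` is a CM type of `(D₄, r²)`. [folklore] -/
theorem dihedral_isCMF : ∀ x : DihedralGroup 4,
    x ∈ ({r 0, r 1, sr 0, sr 1} : Finset (DihedralGroup 4)) ↔ r 2 * x ∉ ({r 0, r 1, sr 0, sr 1} : Finset (DihedralGroup 4)) := by decide

/-- The four base changes of `X₀`: every right translate of `X₀` is `X₀`, `X₀·r²`, `X₀·s` or `X₀·(r² s)`. [folklore] -/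
theorem dihedral_base : ∀ d : DihedralGroup 4,
    (∀ x : DihedralGroup 4, (x * d ∈ ({r 0, r 1, sr 0, sr 1} : Finset (DihedralGroup 4)) ↔ x ∈ ({r 0, r 1, sr 0, sr 1} : Finset (DihedralGroup 4)))) ∨
    (∀ x : DihedralGroup 4, (x * d ∈ ({r 0, r 1, sr 0, sr 1} : Finset (DihedralGroup 4)) ↔
      x * r 2 ∈ ({r 0, r 1, sr 0, sr 1} : Finset (DihedralGroup 4)))) ∨
    (∀ x : DihedralGroup 4, (x * d ∈ ({r 0, r 1, sr 0, sr 1} : Finset (DihedralGroup 4)) ↔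
      x * sr 0 ∈ ({r 0, r 1, sr 0, sr 1} : Finset (DihedralGroup 4)))) ∨
    (∀ x : DihedralGroup 4, (x * d ∈ ({r 0, r 1, sr 0, sr 1} : Finset (DihedralGroup 4)) ↔
      x * (r 2 * sr 0) ∈ ({r 0, r 1, sr 0, sr 1} : Finset (DihedralGroup 4)))) := by decide

/-- The places of `X₀` moved by the swap `s`: `x ∈ X₀` with `x·s ∉ X₀` iff `x ∈ {r, sr}`. [folklore] -/
theorem dihedral_H : ∀ x : DihedralGroup 4,
    (x ∈ ({r 0, r 1, sr 0, sr 1} : Finset (DihedralGroup 4)) ∧ x * sr 0 ∉ ({r 0, r 1, sr 0, sr 1} : Finset (DihedralGroup 4))) ↔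
      x ∈ ({r 1, sr 1} : Finset (DihedralGroup 4)) := by decide

/-- … and `x ∈ X₀` with `x·s ∈ X₀` iff `x ∈ {1, s}`. [folklore] -/
theorem dihedral_Hc : ∀ x : DihedralGroup 4,
    (x ∈ ({r 0, r 1, sr 0, sr 1} : Finset (DihedralGroup 4)) ∧ x * sr 0 ∈ ({r 0, r 1, sr 0, sr 1} : Finset (DihedralGroup 4))) ↔
      x ∈ ({r 0, sr 0} : Finset (DihedralGroup 4)) := by decide

/-- The place permutation of the swap preserves `{r, sr}` on `X₀`-representatives. [folklore] -/
theorem dihedral_sigma_H : ∀ x y : DihedralGroup 4, x ∈ ({r 0, r 1, sr 0, sr 1} : Finset (DihedralGroup 4)) →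
    y ∈ ({r 0, r 1, sr 0, sr 1} : Finset (DihedralGroup 4)) → (y = x * sr 0 ∨ y = r 2 * (x * sr 0)) →
      (x ∈ ({r 1, sr 1} : Finset (DihedralGroup 4)) ↔ y ∈ ({r 1, sr 1} : Finset (DihedralGroup 4))) := by decide

/-- The place permutation of the swap exchanges `r ↔ sr` and `1 ↔ s`. [folklore] -/
theorem dihedral_sigma_val : ∀ x y : DihedralGroup 4, x ∈ ({r 0, r 1, sr 0, sr 1} : Finset (DihedralGroup 4)) →
    y ∈ ({r 0, r 1, sr 0, sr 1} : Finset (DihedralGroup 4)) → (y = x * sr 0 ∨ y = r 2 * (x * sr 0)) →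
      ((x = r 1 ↔ y = sr 1) ∧ (x = sr 1 ↔ y = r 1) ∧ (x = r 0 ↔ y = sr 0) ∧ (x = sr 0 ↔ y = r 0)) := by decide

/-- `{r, sr} ⊆ X₀` and `{1, s} ⊆ X₀`. [folklore] -/
theorem dihedral_sub : (∀ d : DihedralGroup 4, d ∈ ({r 1, sr 1} : Finset (DihedralGroup 4)) → d ∈ ({r 0, r 1, sr 0, sr 1} : Finset (DihedralGroup 4))) ∧
    (∀ d : DihedralGroup 4, d ∈ ({r 0, sr 0} : Finset (DihedralGroup 4)) → d ∈ ({r 0, r 1, sr 0, sr 1} : Finset (DihedralGroup 4))) := by decide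

/-! ## §2 The datum of `D₄ × E` -/

section Model

variable (E : Type) [Group E] [Fintype E] [DecidableEq E]

omit [Group E] [DecidableEq E] in
/-- Membership in the product finset `X ×ˢ univ`. [folklore] -/
theorem mem_prod_univ (X : Finset (DihedralGroup 4)) (P : DihedralGroup 4 × E) : P ∈ X ×ˢ (univ : Finset E) ↔ P.1 ∈ X := by
  rw [mem_product]; simp only [mem_univ, and_true]

omit [Fintype E] [DecidableEq E] in
/-- `c² = 1` for `c = (r², 1)`. [folklore] -/
theorem prod_c_mul_c : ((r 2, 1) : DihedralGroup 4 × E) * (r 2, 1) = 1 :=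
  Prod.ext (show r 2 * r 2 = (1 : DihedralGroup 4) by decide) (mul_one 1)

omit [Fintype E] [DecidableEq E] in
/-- `Q² = 1` for the swap `Q = (s, 1)`. [folklore] -/
theorem prod_Q_mul_Q : ((sr 0, 1) : DihedralGroup 4 × E) * (sr 0, 1) = 1 :=
  Prod.ext (show sr 0 * sr 0 = (1 : DihedralGroup 4) by decide) (mul_one 1)

omit [DecidableEq E] in
/-- `T₀ = X₀ × E` is a CM type of `(D₄ × E, (r², 1))`. [folklore] -/
theorem isCMF_prod : IsCMF ((r 2, 1) : DihedralGroup 4 × E) (({r 0, r 1, sr 0, sr 1} : Finset (DihedralGroup 4)) ×ˢ (univ : Finset E)) := by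
  intro P
  rw [mem_prod_univ, mem_prod_univ, Prod.fst_mul]
  exact dihedral_isCMF P.1

/-- **THE DIHEDRAL FACTOR LAW.**  `E` a finite group of order `2ᵏ`, `k ≥ 2`; `G = D₄ × E`, `c = (r², 1)`:  **`μ(G, c) = φ₂(G, c)`** — the least number of faces
whose base changes together with the pairs generate the Hodge lattice is the coinvariant fibre. [folklore] -/
theorem isLeast_card_gfaces_generate_dihedral_prod (k : ℕ) (hk : 2 ≤ k) (hE : Fintype.card E = 2 ^ k) :
    IsLeast {n : ℕ | ∃ S : Finset (CMF (DihedralGroup 4 × E) ((r 2, 1) : DihedralGroup 4 × E) →₀ ℤ),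
      (↑S ⊆ gfaceSet (DihedralGroup 4 × E) ((r 2, 1) : DihedralGroup 4 × E) (prod_c_mul_c E)) ∧ S.card = n ∧
      hodgeSpan ((r 2, 1) : DihedralGroup 4 × E) (prod_c_mul_c E) ≤
        Submodule.span ℤ (pairSet ((r 2, 1) : DihedralGroup 4 × E)) ⊔ Submodule.span ℤ (translates ((r 2, 1) : DihedralGroup 4 × E) S)}
      (fibreTwo ((r 2, 1) : DihedralGroup 4 × E) (prod_c_mul_c E)) := by
  classical
  set c : DihedralGroup 4 × E := (r 2, 1) with hc
  have hc2 : c * c = 1 := prod_c_mul_c E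
  have hc1 : c ≠ 1 := by
    intro h
    have h1 : (r 2 : DihedralGroup 4) = 1 := congrArg Prod.fst h
    exact absurd h1 (by decide)
  have hcen : ∀ x : DihedralGroup 4 × E, x * c = c * x := by
    intro x; ext
    · change x.1 * r 2 = r 2 * x.1; have h : ∀ d : DihedralGroup 4, d * r 2 = r 2 * d := by decide
      exact h x.1
    · change x.2 * 1 = 1 * x.2; rw [mul_one, one_mul]
  -- the `2`-group
  have hG : IsPGroup 2 (DihedralGroup 4 × E) := by
    refine IsPGroup.of_card (n := k + 3) ?_
    rw [Nat.card_eq_fintype_card, Fintype.card_prod, hE, DihedralGroup.card]; ring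
  -- the datum
  set X₀ : Finset (DihedralGroup 4) := {r 0, r 1, sr 0, sr 1} with hX₀
  let T₀ : CMF (DihedralGroup 4 × E) c := ⟨X₀ ×ˢ (univ : Finset E), isCMF_prod E⟩
  set Q : DihedralGroup 4 × E := (sr 0, 1) with hQdef
  let T₁ : CMF (DihedralGroup 4 × E) c := rt c Q T₀
  have hT₀mem : ∀ P : DihedralGroup 4 × E, P ∈ T₀.1 ↔ P.1 ∈ X₀ := fun P => mem_prod_univ E X₀ P
  have hT₁mem : ∀ P : DihedralGroup 4 × E, P ∈ T₁.1 ↔ P.1 * sr 0 ∈ X₀ := fun P => by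
    change P ∈ (rt c Q T₀).1 ↔ _; rw [mem_rt, hT₀mem]; rfl
  have hrtmem : ∀ (R P : DihedralGroup 4 × E), P ∈ (rt c R T₀).1 ↔ P.1 * R.1 ∈ X₀ := fun R P => by rw [mem_rt, hT₀mem]; rfl
  -- 𝓗 and 𝓗ᶜ
  have hHset : T₀.1 \ T₁.1 = ({r 1, sr 1} : Finset (DihedralGroup 4)) ×ˢ (univ : Finset E) := by
    ext P; rw [mem_sdiff, hT₀mem, hT₁mem, mem_prod_univ]; exact dihedral_H P.1
  have hHcset : T₀.1 ∩ T₁.1 = ({r 0, sr 0} : Finset (DihedralGroup 4)) ×ˢ (univ : Finset E) := by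
    ext P; rw [mem_inter, hT₀mem, hT₁mem, mem_prod_univ]; exact dihedral_Hc P.1
  have hm4 : 4 ≤ Fintype.card E := by
    rw [hE]; calc 4 = 2 ^ 2 := by norm_num
      _ ≤ 2 ^ k := Nat.pow_le_pow_right (by norm_num) hk
  refine isLeast_card_gfaces_generate_four c hG hc2 hc1 hcen T₀ T₁ ?_ (Fintype.card E) (by omega) ?_ ?_ Q rfl (prod_Q_mul_Q E) ?_ ?_ ?_
  · -- the base block
    intro R
    have hcases := dihedral_base R.1
    have hrr : ∀ P : DihedralGroup 4 × E, P ∈ (rt c c T₀).1 ↔ P.1 * r 2 ∈ X₀ := fun P => hrtmem c P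
    have hrT₁ : ∀ P : DihedralGroup 4 × E, P ∈ (rt c c T₁).1 ↔ P.1 * (r 2 * sr 0) ∈ X₀ := fun P => by
      change P ∈ (rt c c (rt c Q T₀)).1 ↔ _; rw [← rt_mul, hrtmem]; rfl
    rcases hcases with h | h | h | h
    · exact Or.inl (Subtype.ext (Finset.ext fun P => by rw [hrtmem, hT₀mem]; exact h P.1))
    · exact Or.inr (Or.inl (Subtype.ext (Finset.ext fun P => by rw [hrtmem, hrr]; exact h P.1)))
    · exact Or.inr (Or.inr (Or.inl (Subtype.ext (Finset.ext fun P => by rw [hrtmem, hT₁mem]; exact h P.1))))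
    · exact Or.inr (Or.inr (Or.inr (Subtype.ext (Finset.ext fun P => by rw [hrtmem, hrT₁]; exact h P.1))))
  · -- `|T₀| = 4m`
    change (X₀ ×ˢ (univ : Finset E)).card = 4 * Fintype.card E
    rw [card_product, card_univ]; congr 1
  · -- `|𝓗| = 2m`
    rw [hHset, card_product, card_univ]; congr 1
  · -- the swap preserves `𝓗`
    intro t ht t' ht' h
    rw [hT₀mem] at ht ht'
    have h1 : t'.1 = t.1 * sr 0 ∨ t'.1 = r 2 * (t.1 * sr 0) := by
      rcases h with h | h
      · left; rw [h]; rfl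
      · right; rw [h]; rfl
    have hσ := dihedral_sigma_H t.1 t'.1 ht ht' h1
    rw [hHset, mem_prod_univ, mem_prod_univ]; exact hσ
  · -- the transversal `{r} × E ⊆ 𝓗`
    refine ⟨({r 1} : Finset (DihedralGroup 4)) ×ˢ (univ : Finset E), ?_, ?_, ?_⟩
    · rw [hHset]; exact product_subset_product_left (by decide)
    · rw [card_product, card_singleton, card_univ, one_mul]
    · intro t ht t' ht' h
      rw [hHset, mem_prod_univ] at ht
      rw [hT₀mem] at ht'
      have h1 : t'.1 = t.1 * sr 0 ∨ t'.1 = r 2 * (t.1 * sr 0) := by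
        rcases h with h | h
        · left; rw [h]; rfl
        · right; rw [h]; rfl
      have htX : t.1 ∈ X₀ := dihedral_sub.1 t.1 ht
      obtain ⟨h2, h3, -, -⟩ := dihedral_sigma_val t.1 t'.1 htX ht' h1
      rw [mem_prod_univ, mem_prod_univ, mem_singleton, mem_singleton]
      have ht2 : t.1 = r 1 ∨ t.1 = sr 1 := by
        have : t.1 ∈ ({r 1, sr 1} : Finset (DihedralGroup 4)) := ht
        rwa [mem_insert, mem_singleton] at this
      constructor
      · intro e; rw [h2.mp e]; decide
      · intro hne
        rcases ht2 with e | e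
        · exact e
        · exact absurd (h3.mp e) hne
  · -- the transversal `{1} × E ⊆ T₀ ∩ T₁`
    refine ⟨({r 0} : Finset (DihedralGroup 4)) ×ˢ (univ : Finset E), ?_, ?_, ?_⟩
    · rw [hHcset]; exact product_subset_product_left (by decide)
    · rw [card_product, card_singleton, card_univ, one_mul]
    · intro t ht t' ht' h
      rw [hHcset, mem_prod_univ] at ht
      rw [hT₀mem] at ht'
      have h1 : t'.1 = t.1 * sr 0 ∨ t'.1 = r 2 * (t.1 * sr 0) := by
        rcases h with h | h
        · left; rw [h]; rfl
        · right; rw [h]; rfl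
      have htX : t.1 ∈ X₀ := dihedral_sub.2 t.1 ht
      obtain ⟨-, -, h4, h5⟩ := dihedral_sigma_val t.1 t'.1 htX ht' h1
      rw [mem_prod_univ, mem_prod_univ, mem_singleton, mem_singleton]
      have ht2 : t.1 = r 0 ∨ t.1 = sr 0 := by
        have : t.1 ∈ ({r 0, sr 0} : Finset (DihedralGroup 4)) := ht
        rwa [mem_insert, mem_singleton] at this
      constructor
      · intro e; rw [h4.mp e]; decide
      · intro hne
        rcases ht2 with e | e
        · exact e
        · exact absurd (h5.mp e) hne

end Model

end

end Summit.HodgeConjecture.CorCM.Census.CentralSquares
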